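import Mathlib
import Summits.NavierStokesRegularity.Statement
import Summits.NavierStokesRegularity.NavierStokesRegularity.Theses.LandauTail
import Summits.NavierStokesRegularity.NavierStokesRegularity.Theorems.BlowupAssembly
import Summits.NavierStokesRegularity.NavierStokesRegularity.Theorems.LandauTailTailForcesBlowup

/-!
# NavierStokesRegularity — route `LandauTail`, rank-1 assembly

Settles `stmt-NavierStokesRegularity-1945` (positive): the glue
`X → X5b → ¬ NavierStokesRegularity`, where `X = LandauTailBlowup` (a classical Leray–Hopf
solution from a rapidly decaying datum with a parabolic-scale Landau tail at some `(xs, T)`) and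
`X5b = ClayUniqueness` (`stmt-NavierStokesRegularity-0153` verbatim: Fefferman class-(A) solutions
agree with the classical Leray–Hopf solution from the same datum on its interval of existence).

Proof (pure composition of two accepted tree theorems, no analysis):
`Summit.NavierStokesRegularity.NavierStokesRegularity.Theorems.tailForcesBlowup_proof`
(`TailForcesBlowup`, stmt-…-1950) turns the Landau-tailed solution into a maximal smooth
Leray–Hopf solution with lifespan `T` (`X5a = Blowup.BlowupExists`, stmt-…-0152 verbatim), and the
proved glue `Literature.NS.blowup_assembly` (stmt-…-0151) applied to `(X5a, X5b)` refutes Clay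
statement (A).
-/

-- the summit-side namespace `Summit.NavierStokesRegularity.NavierStokesRegularity.…` repeats a component by design (D-0017)
set_option linter.dupNamespace false

namespace Summit.NavierStokesRegularity.NavierStokesRegularity.Theorems

/-- Settles stmt-NavierStokesRegularity-1945 (`Assembly`, route `LandauTail`): a Landau-tailed
finite-energy classical solution from a rapidly decaying datum (`LandauTailBlowup`) together with
Clay-class uniqueness (`ClayUniqueness`) refutes `NavierStokesRegularity`. Composition of
`tailForcesBlowup_proof` (Landau tail ⇒ no smooth extension past `T`, i.e. `X5a`) with the glue
`Literature.NS.blowup_assembly` (`X5a ∧ X5b → ¬(A)`). [folklore] -/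
theorem landauTail_assembly_proof :
    Summit.NavierStokesRegularity.NavierStokesRegularity.Theses.LandauTail.Assembly := by
  unfold Summit.NavierStokesRegularity.NavierStokesRegularity.Theses.LandauTail.Assembly
  intro hX h5b
  have hglue := tailForcesBlowup_proof
  unfold Summit.NavierStokesRegularity.NavierStokesRegularity.Theses.LandauTail.TailForcesBlowup
    at hglue
  exact Literature.NS.blowup_assembly ⟨hglue hX, h5b⟩

end Summit.NavierStokesRegularity.NavierStokesRegularity.Theorems
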